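import Summits.NavierStokesRegularity.FunctionalMining.TopEigHeatDanskin
import Summits.NavierStokesRegularity.FunctionalMining.TopEigProductionReverse
import HarnessLib

/-!
# FunctionalMining / NoGo — K49: THE EXPONENT VARIATION OF AN EXACT (F2) WITNESS — the Danskin
# integral is `C¹` in `q` on `(1, ∞)`; an exact witness at an interior exponent balances the
# LOG-TILTED Danskin mass; `ε`-violation is an open condition in `q`

Search for candidate a priori estimates; no regularity claim. Cell `pub-nsfunc`, no-go seat
(gen 50, touch 8). Door (b) = (F2) of `NOGO.md` is the WANTED kernel statement
`¬ TopEigHeatCoercivePos q`; an exact witness is a smooth divergence-free (zero-mean) field `v` on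
`T³` with `Φ_q(v) > 0` and `heatDissipation Φ_q v = 0` (K46: the exact member of a finite family;
K47: melting tops; K48: twin point of the top strain eigenvalue). This file varies the EXPONENT
`q` at a fixed field.

Notation: `λ₁ = torusStrainTopEig v ≥ 0` (divergence free), `μ = μ(S(v); S(w))` the Danskin
density `dirTopEig (strainFlat v x) (strainFlat w x)`, `g_w(q) = ∫ q λ₁^{q−1} μ`. By the tree's
Danskin formula (`heatDissipation_topEigMoment_eq_integral`, dictionary seat)
`heatDissipation Φ_q v = −g_{Δv}(q)` for every real `q ≥ 1`, and by the heat sieve on `T³`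
(`integral_danskinDensity_laplacian_nonpos`) `g_{Δv}(q) ≤ 0` for every `q ≥ 1`.

WHAT IS PROVED (namespace `Summit.NavierStokesRegularity.FunctionalMining.TopEig`):
1. `hasDerivAt_danskinIntegral_exponent` (any `d`) — for `v, w` smooth, `v` divergence free and
   `q₀ > 1`, `q ↦ g_w(q)` is differentiable at `q₀` with derivative
   `∫ (λ₁^{q₀−1} + q₀ λ₁^{q₀−1} log λ₁) μ` (differentiation under the integral sign: on the ball
   `|q − q₀| < (q₀−1)/2` the `q`-derivative of the density is dominated by a continuous function,
   through the scalar bounds `l^s ≤ 1 + l^σ`, `l^s |log l| ≤ (1 + l^σ)(1/ε + l)` for `0 ≤ l`,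
   `0 < ε ≤ s ≤ σ`; at strain zeros the density vanishes identically near `q₀`). Hence
   `hasDerivAt_heatDissipation_exponent` / `continuousAt_heatDissipation_exponent`:
   `q ↦ heatDissipation Φ_q v` is differentiable, so continuous, at every `q₀ > 1`; and
   `continuousAt_topEigMoment_exponent`: `q ↦ Φ_q(v)` is continuous at every `q₀ > 0` (`v` smooth
   only; dominated convergence).
2. **`integral_logTilt_eq_zero_of_exact` — THE LOG-TILT BALANCE (`T³`).** If `v` is smooth and
   divergence free, `q₀ > 1` and `heatDissipation Φ_{q₀} v = 0`, then
   `∫ λ₁^{q₀−1} · log λ₁ · μ(S; ΔS) = 0`.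
   Proof: `g_{Δv} ≤ 0` on `[1, ∞)`, a neighbourhood of `q₀`, and `g_{Δv}(q₀) = 0`; so `q₀` is a
   local maximum of a function differentiable there, its derivative
   `∫ λ₁^{q₀−1} μ + q₀ ∫ λ₁^{q₀−1} log λ₁ μ` vanishes (`IsLocalMax.hasDerivAt_eq_zero`), and the
   first summand is `g_{Δv}(q₀)/q₀ = 0` (`integral_weight_danskin_eq_zero_of_exact`, any `d`).
   `exact_witness_exponent_portrait` records both balances; equivalently
   (`hasDerivAt_heatDissipation_exponent_zero_of_exact`) the `q`-derivative of
   `q ↦ heatDissipation Φ_q v` VANISHES at an interior exact exponent: exactness is a tangency.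
3. `eventually_lt_nhds_exponent_of_lt` (any `d`) — `ε`-VIOLATION IS OPEN IN `q`: if
   `heatDissipation Φ_{q₀} v < ε · Φ_{q₀}(v)` at some `q₀ > 1`, the same strict inequality holds
   for all `q` near `q₀` (continuity of both sides in `q`).

MEANING FOR THE (F2) SEARCH (design rules, on top of K42–K48):
(R6) an exact witness at an INTERIOR exponent `q₀ > 1` satisfies TWO scalar balance laws under
  the weight `λ₁^{q₀−1}`: the Danskin mass `∫ λ₁^{q₀−1} μ = 0` (K48 §2) and the log-tilt
  `∫ λ₁^{q₀−1} log λ₁ · μ = 0` — the melting mass `μ > 0` (on the saddle structure of `λ₁`, K47)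
  and the freezing mass `μ < 0` have the same `λ₁^{q₀−1}`-weighted mean of `log λ₁`. Exactness at
  an interior `q` is a TANGENCY in `q` (the violation function `q ↦ −heatDissipation Φ_q v ≤ 0`
  touches `0`), so exact members of finite-parameter designs (K46's exact branch) are doubly
  non-generic there; this is consistent with the endpoint picture at `q = 1` (K32: L-λ(1) fails;
  K33: `C_λ(q) ≤ K(q−1)`), where only a one-sided slope condition would apply.
(R7) the violation profile of ONE design is continuous in `q` on `(1, ∞)`: a strict `ε`-violator
  at `q₀` is one on a `q`-interval around `q₀`; consequently (prose — `C_λ` is not a tree object)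
  `q ↦ C_λ(q) = inf_v heatDissipation Φ_q v / Φ_q(v)` is upper semicontinuous on `(1, ∞)`, its
  sub-level sets `{C_λ < c}` are open and the failure set `{q > 1 : ¬ TopEigHeatCoercivePos q}`
  is a `G_δ`.
HONEST CAVEAT (design value): (R6) is a necessary condition only — one more equation, no
construction; nothing is said at `q₀ = 1` itself (there `log λ₁` need not be `μ`-integrable), and
no second-order condition in `q` is recorded. NOT CLAIMED: any node of the dictionary, any value
of `C_λ(q)`, Navier–Stokes regularity. L-λ(q) stays OPEN for every real `q > 1`. [ours]
FILING (prove seat g29, REQUEST #75): declarations byte-identical to the no-go seat's staged `TopEigHeatLogTilt.STAGING.lean` cf55bfea1761ae70; this line is the only addition.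
-/

noncomputable section

open MeasureTheory Set Filter Topology Metric

namespace Summit.NavierStokesRegularity.FunctionalMining

open Literature.Analysis.FunctionSpaces

namespace TopEig

variable {d : Type*} [Fintype d] [DecidableEq d] [Nonempty d]

/-! ## 1. Two scalar bounds for the dominated-derivative argument -/

/-- `l^s ≤ 1 + l^σ` for `0 ≤ l` and `0 ≤ s ≤ σ` (a `private` twin, `rpow_le_one_add_rpow_oc`, is in
`Literature.Analysis.FluidPDE`, unimportable; restated here). [folklore] -/
theorem rpow_le_one_add_rpow {l s σ : ℝ} (hl : 0 ≤ l) (hs : 0 ≤ s) (hσ : s ≤ σ) :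
    l ^ s ≤ 1 + l ^ σ := by
  have h0 : 0 ≤ l ^ σ := Real.rpow_nonneg hl σ
  rcases le_or_gt l 1 with h | h
  · have h1 : l ^ s ≤ 1 := Real.rpow_le_one hl h hs
    linarith
  · have h1 : l ^ s ≤ l ^ σ := Real.rpow_le_rpow_of_exponent_le h.le hσ
    linarith

/-- `l^s · |log l| ≤ (1 + l^σ)(1/ε + l)` for `0 ≤ l` and `0 < ε ≤ s ≤ σ` (`l^ε |log l| < 1/ε` on
`(0, 1]`, `log l ≤ l` on `(1, ∞)`; `log 0 = 0`). [folklore] -/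
theorem rpow_mul_abs_log_le {l s σ ε : ℝ} (hl : 0 ≤ l) (hε : 0 < ε) (hs : ε ≤ s) (hσ : s ≤ σ) :
    l ^ s * |Real.log l| ≤ (1 + l ^ σ) * (1 / ε + l) := by
  have h0 : 0 ≤ l ^ σ := Real.rpow_nonneg hl σ
  have hε' : 0 < 1 / ε := one_div_pos.mpr hε
  rcases hl.eq_or_lt with h00 | hpos
  · rw [← h00, Real.log_zero, abs_zero, mul_zero]
    positivity
  rcases le_or_gt l 1 with h1 | h1
  · have hA : l ^ s = l ^ (s - ε) * l ^ ε := by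
      rw [← Real.rpow_add hpos]; ring_nf
    have hB : l ^ (s - ε) ≤ 1 := Real.rpow_le_one hl h1 (by linarith)
    have hC : |Real.log l * l ^ ε| < 1 / ε := Real.abs_log_mul_self_rpow_lt l ε hpos h1 hε
    rw [abs_mul, abs_of_nonneg (Real.rpow_nonneg hl ε)] at hC
    have hC' : l ^ ε * |Real.log l| ≤ 1 / ε := by rw [mul_comm]; exact hC.le
    calc l ^ s * |Real.log l| = l ^ (s - ε) * (l ^ ε * |Real.log l|) := by rw [hA]; ring
      _ ≤ 1 * (1 / ε) := mul_le_mul hB hC' (by positivity) zero_le_one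
      _ ≤ (1 + l ^ σ) * (1 / ε + l) := by nlinarith
  · have hA : l ^ s ≤ l ^ σ := Real.rpow_le_rpow_of_exponent_le h1.le hσ
    have hB : |Real.log l| ≤ l := by
      rw [abs_of_nonneg (Real.log_nonneg h1.le)]
      linarith [Real.log_le_sub_one_of_pos hpos]
    calc l ^ s * |Real.log l| ≤ l ^ σ * l := mul_le_mul hA hB (abs_nonneg _) h0
      _ ≤ (1 + l ^ σ) * (1 / ε + l) := by nlinarith

/-- The bound on the `q`-derivative of the density: for `0 ≤ l`, `0 < ε ≤ s ≤ σ`, `0 ≤ q ≤ Q` and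
`|m| ≤ M`, `|(l^s + q l^s log l) m| ≤ (1 + l^σ)(1 + Q(1/ε + l)) M`. [folklore] -/
theorem abs_exponentDeriv_density_le {l m s σ ε q Q M : ℝ} (hl : 0 ≤ l) (hε : 0 < ε) (hs : ε ≤ s)
    (hσ : s ≤ σ) (hq : 0 ≤ q) (hQ : q ≤ Q) (hm : |m| ≤ M) :
    |(l ^ s + q * (l ^ s * Real.log l)) * m| ≤ (1 + l ^ σ) * (1 + Q * (1 / ε + l)) * M := by
  have h1 := rpow_le_one_add_rpow hl (hε.le.trans hs) hσ
  have h2 := rpow_mul_abs_log_le hl hε hs hσ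
  have hls : 0 ≤ l ^ s := Real.rpow_nonneg hl s
  have hA : |l ^ s + q * (l ^ s * Real.log l)| ≤ l ^ s + q * (l ^ s * |Real.log l|) := by
    calc |l ^ s + q * (l ^ s * Real.log l)| ≤ |l ^ s| + |q * (l ^ s * Real.log l)| := abs_add_le _ _
      _ = l ^ s + q * (l ^ s * |Real.log l|) := by
          rw [abs_of_nonneg hls, abs_mul, abs_of_nonneg hq, abs_mul, abs_of_nonneg hls]
  have hB : l ^ s + q * (l ^ s * |Real.log l|) ≤ (1 + l ^ σ) * (1 + Q * (1 / ε + l)) := by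
    have h3 : q * (l ^ s * |Real.log l|) ≤ Q * ((1 + l ^ σ) * (1 / ε + l)) :=
      mul_le_mul hQ h2 (by positivity) (hq.trans hQ)
    calc l ^ s + q * (l ^ s * |Real.log l|) ≤ (1 + l ^ σ) + Q * ((1 + l ^ σ) * (1 / ε + l)) :=
          add_le_add h1 h3
      _ = (1 + l ^ σ) * (1 + Q * (1 / ε + l)) := by ring
  rw [abs_mul]
  exact mul_le_mul (hA.trans hB) hm (abs_nonneg m) ((abs_nonneg _).trans (hA.trans hB))

/-! ## 2. The pointwise `q`-derivative of the Danskin density -/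

/-- For `l ≥ 0` and `q > 1`, `r ↦ r · l^{r−1} · m` has derivative `(l^{q−1} + q l^{q−1} log l) m`
at `q` (for `l = 0` the function vanishes identically on `(1, ∞)`, and so does the stated
derivative). [folklore] -/
theorem hasDerivAt_exponent_density {l m q : ℝ} (hl : 0 ≤ l) (hq : 1 < q) :
    HasDerivAt (fun r : ℝ => r * l ^ (r - 1) * m)
      ((l ^ (q - 1) + q * (l ^ (q - 1) * Real.log l)) * m) q := by
  rcases hl.eq_or_lt with h0 | hpos
  · have hz : l ^ (q - 1) = 0 := by rw [← h0]; exact Real.zero_rpow (sub_pos.mpr hq).ne'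
    have h : (fun r : ℝ => r * l ^ (r - 1) * m) =ᶠ[𝓝 q] fun _ => 0 := by
      filter_upwards [Ioi_mem_nhds hq] with r hr
      have hr' : r - 1 ≠ 0 := (sub_pos.mpr (by simpa only [Set.mem_Ioi] using hr)).ne'
      rw [← h0, Real.zero_rpow hr', mul_zero, zero_mul]
    simpa only [hz, zero_mul, mul_zero, add_zero] using
      (hasDerivAt_const q (0:ℝ)).congr_of_eventuallyEq h
  · have h : HasDerivAt (fun r : ℝ => l ^ (r - 1)) (l ^ (q - 1) * Real.log l) q := by
      have h := (hasDerivAt_const q l).rpow ((hasDerivAt_id q).sub_const 1) hpos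
      simp only [id, zero_mul, one_mul, zero_add] at h
      exact h
    simpa using ((hasDerivAt_id q).mul h).mul_const m

/-! ## 3. Differentiation under the integral sign: `q ↦ ∫ q λ₁^{q−1} μ` is `C¹` on `(1, ∞)` -/

/-- **The Danskin integral is differentiable in the exponent.** For `v, w` smooth on `T^d`, `v`
divergence free, and `q₀ > 1`: the `q`-derivative density is integrable at `q₀` and
`q ↦ ∫ q λ₁^{q−1} μ(S(v); S(w))` has derivative `∫ (λ₁^{q₀−1} + q₀ λ₁^{q₀−1} log λ₁) μ` at `q₀`
(`hasDerivAt_integral_of_dominated_loc_of_deriv_le` on the ball of radius `(q₀−1)/2`, dominating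
function `(1 + λ₁^σ)(1 + Q(1/ε + λ₁)) ‖S(w)‖`, continuous hence integrable on the torus). [ours] -/
theorem hasDerivAt_danskinIntegral_exponent {q₀ : ℝ} (hq₀ : 1 < q₀)
    {v w : UnitAddTorus d → EuclideanSpace ℝ d} (hv : Torus.IsSmooth v) (hw : Torus.IsSmooth w)
    (hdiv : Torus.IsDivFree v) :
    Integrable (fun x => (torusStrainTopEig v x ^ (q₀ - 1) +
        q₀ * (torusStrainTopEig v x ^ (q₀ - 1) * Real.log (torusStrainTopEig v x))) *
        dirTopEig (StrainL4.strainFlat v x) (StrainL4.strainFlat w x)) volume ∧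
    HasDerivAt (fun q : ℝ => ∫ x, q * torusStrainTopEig v x ^ (q - 1) *
        dirTopEig (StrainL4.strainFlat v x) (StrainL4.strainFlat w x))
      (∫ x, (torusStrainTopEig v x ^ (q₀ - 1) +
        q₀ * (torusStrainTopEig v x ^ (q₀ - 1) * Real.log (torusStrainTopEig v x))) *
        dirTopEig (StrainL4.strainFlat v x) (StrainL4.strainFlat w x)) q₀ := by
  set ε : ℝ := (q₀ - 1) / 2 with hε_def
  have hε : 0 < ε := by rw [hε_def]; linarith
  have hlam : Continuous fun x => torusStrainTopEig v x := continuous_torusStrainTopEig hv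
  have hl0 : ∀ x, 0 ≤ torusStrainTopEig v x := fun x => by
    rw [← lam_strainFlat]; exact lam_strainFlat_nonneg hv hdiv x
  have hμ : AEStronglyMeasurable
      (fun x => dirTopEig (StrainL4.strainFlat v x) (StrainL4.strainFlat w x)) volume := by
    simpa using aestronglyMeasurable_danskinDensity (q := 1) le_rfl hv hw
  have hball : ∀ q ∈ ball q₀ ε, 1 < q ∧ ε ≤ q - 1 ∧ q - 1 ≤ q₀ - 1 + ε ∧ q ≤ q₀ + ε := by
    intro q hq
    rw [mem_ball, Real.dist_eq, abs_lt] at hq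
    obtain ⟨h1, h2⟩ := hq
    refine ⟨by linarith, by linarith, by linarith, by linarith⟩
  refine hasDerivAt_integral_of_dominated_loc_of_deriv_le
    (F := fun q x => q * torusStrainTopEig v x ^ (q - 1) *
      dirTopEig (StrainL4.strainFlat v x) (StrainL4.strainFlat w x))
    (F' := fun q x => (torusStrainTopEig v x ^ (q - 1) +
      q * (torusStrainTopEig v x ^ (q - 1) * Real.log (torusStrainTopEig v x))) *
      dirTopEig (StrainL4.strainFlat v x) (StrainL4.strainFlat w x))
    (bound := fun x => (1 + torusStrainTopEig v x ^ (q₀ - 1 + ε)) *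
      (1 + (q₀ + ε) * (1 / ε + torusStrainTopEig v x)) * ‖StrainL4.strainFlat w x‖)
    (ball_mem_nhds q₀ hε) ?_ (integrable_danskinDensity hq₀.le hv hw hdiv) ?_ ?_ ?_ ?_
  · filter_upwards [Ioi_mem_nhds hq₀] with q hq
    exact aestronglyMeasurable_danskinDensity (le_of_lt hq) hv hw
  · have h1 : Continuous fun x => torusStrainTopEig v x ^ (q₀ - 1) :=
      hlam.rpow_const fun _ => Or.inr (by linarith)
    have h2 : Measurable fun x => Real.log (torusStrainTopEig v x) :=
      Real.measurable_log.comp hlam.measurable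
    exact ((h1.measurable.add
      (measurable_const.mul (h1.measurable.mul h2))).aestronglyMeasurable).mul hμ
  · refine ae_of_all _ fun x q hq => ?_
    obtain ⟨_, hs, hσ, hQ⟩ := hball q hq
    rw [Real.norm_eq_abs]
    exact abs_exponentDeriv_density_le (hl0 x) hε hs hσ (by linarith) hQ (abs_dirTopEig_le_norm _ _)
  · have h1 : Continuous fun x => torusStrainTopEig v x ^ (q₀ - 1 + ε) :=
      hlam.rpow_const fun _ => Or.inr (by linarith)
    exact (((continuous_const.add h1).mul (continuous_const.add (continuous_const.mul
      (continuous_const.add hlam)))).mul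
        (StrainL4.continuous_strainFlat hw).norm).integrable_unitAddTorus
  · exact ae_of_all _ fun x q hq => hasDerivAt_exponent_density (hl0 x) (hball q hq).1

/-- **`q ↦ heatDissipation Φ_q v` is differentiable at every `q₀ > 1`** (smooth divergence-free
`v` on `T^d`), with derivative `−∫ (λ₁^{q₀−1} + q₀ λ₁^{q₀−1} log λ₁) μ(S; ΔS)` (Danskin's formula on
`(1, ∞)` and § 3). [ours] -/
theorem hasDerivAt_heatDissipation_exponent {q₀ : ℝ} (hq₀ : 1 < q₀)
    {v : UnitAddTorus d → EuclideanSpace ℝ d} (hv : Torus.IsSmooth v) (hdiv : Torus.IsDivFree v) :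
    HasDerivAt (fun q : ℝ => heatDissipation (torusTopEigMoment q) v)
      (-∫ x, (torusStrainTopEig v x ^ (q₀ - 1) +
        q₀ * (torusStrainTopEig v x ^ (q₀ - 1) * Real.log (torusStrainTopEig v x))) *
        dirTopEig (StrainL4.strainFlat v x) (StrainL4.strainFlat (Torus.laplacian v) x)) q₀ := by
  have h := (hasDerivAt_danskinIntegral_exponent hq₀ hv hv.laplacian hdiv).2.neg
  refine h.congr_of_eventuallyEq ?_
  filter_upwards [Ioi_mem_nhds hq₀] with q hq
  exact heatDissipation_topEigMoment_eq_integral (le_of_lt hq) hv hdiv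

/-- `q ↦ heatDissipation Φ_q v` is continuous at every `q₀ > 1`. [ours] -/
theorem continuousAt_heatDissipation_exponent {q₀ : ℝ} (hq₀ : 1 < q₀)
    {v : UnitAddTorus d → EuclideanSpace ℝ d} (hv : Torus.IsSmooth v) (hdiv : Torus.IsDivFree v) :
    ContinuousAt (fun q : ℝ => heatDissipation (torusTopEigMoment q) v) q₀ :=
  (hasDerivAt_heatDissipation_exponent hq₀ hv hdiv).continuousAt

/-- **`q ↦ Φ_q(v)` is continuous at every `q₀ > 0`** (`v` smooth on `T^d`; dominated convergence:
`(λ₁⁺)^q ≤ 1 + (λ₁⁺)^{3q₀/2}` on `|q − q₀| < q₀/2`, and `q ↦ a^q` is continuous at `q₀ ≠ 0` for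
every `a ≥ 0`). [ours] -/
theorem continuousAt_topEigMoment_exponent {q₀ : ℝ} (hq₀ : 0 < q₀)
    {v : UnitAddTorus d → EuclideanSpace ℝ d} (hv : Torus.IsSmooth v) :
    ContinuousAt (fun q : ℝ => torusTopEigMoment q v) q₀ := by
  set ε : ℝ := q₀ / 2 with hε_def
  have hε : 0 < ε := by rw [hε_def]; linarith
  have ha : Continuous fun x => max (torusStrainTopEig v x) 0 :=
    (continuous_torusStrainTopEig hv).max continuous_const
  have hcont : ∀ q : ℝ, 0 < q → Continuous fun x => max (torusStrainTopEig v x) 0 ^ q :=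
    fun q hq => ha.rpow_const fun _ => Or.inr hq.le
  have hball : ∀ᶠ q in 𝓝 q₀, 0 < q ∧ q ≤ q₀ + ε := by
    filter_upwards [ball_mem_nhds q₀ hε] with q hq
    rw [mem_ball, Real.dist_eq, abs_lt] at hq
    obtain ⟨h1, h2⟩ := hq
    exact ⟨by linarith, by linarith⟩
  refine continuousAt_of_dominated (F := fun q x => max (torusStrainTopEig v x) 0 ^ q)
    (bound := fun x => 1 + max (torusStrainTopEig v x) 0 ^ (q₀ + ε)) ?_ ?_ ?_ ?_
  · filter_upwards [hball] with q hq
    exact (hcont q hq.1).aestronglyMeasurable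
  · filter_upwards [hball] with q hq
    refine ae_of_all _ fun x => ?_
    rw [Real.norm_eq_abs, abs_of_nonneg (Real.rpow_nonneg (le_max_right _ _) q)]
    exact rpow_le_one_add_rpow (le_max_right _ _) hq.1.le hq.2
  · exact (continuous_const.add (hcont _ (by linarith))).integrable_unitAddTorus
  · exact ae_of_all _ fun x => Real.continuousAt_const_rpow' hq₀.ne'

/-! ## 4. The log-tilt balance of an exact witness at an interior exponent -/

/-- **Danskin mass balance of an exact witness, weight form** (any `d`, real `q ≥ 1`):
`heatDissipation Φ_q v = 0` gives `∫ λ₁^{q−1} μ(S; ΔS) = 0` (Danskin's formula, divided by `q`).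
[ours] -/
theorem integral_weight_danskin_eq_zero_of_exact {q : ℝ} (hq : 1 ≤ q)
    {v : UnitAddTorus d → EuclideanSpace ℝ d} (hv : Torus.IsSmooth v) (hdiv : Torus.IsDivFree v)
    (hD : heatDissipation (torusTopEigMoment q) v = 0) :
    ∫ x, torusStrainTopEig v x ^ (q - 1) *
      dirTopEig (StrainL4.strainFlat v x) (StrainL4.strainFlat (Torus.laplacian v) x) = 0 := by
  have hq0 : q ≠ 0 := by positivity
  have hg0 : ∫ x, q * torusStrainTopEig v x ^ (q - 1) *
      dirTopEig (StrainL4.strainFlat v x) (StrainL4.strainFlat (Torus.laplacian v) x) = 0 := by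
    have h := heatDissipation_topEigMoment_eq_integral hq hv hdiv
    rw [hD] at h
    linarith
  have h : ∫ x, q * torusStrainTopEig v x ^ (q - 1) *
      dirTopEig (StrainL4.strainFlat v x) (StrainL4.strainFlat (Torus.laplacian v) x) =
      q * ∫ x, torusStrainTopEig v x ^ (q - 1) *
          dirTopEig (StrainL4.strainFlat v x) (StrainL4.strainFlat (Torus.laplacian v) x) := by
    rw [← integral_const_mul]
    exact integral_congr_ae (ae_of_all _ fun x => by ring)
  rw [h] at hg0
  exact (mul_eq_zero.mp hg0).resolve_left hq0

/-- **LOG-TILT BALANCE (`T³`).** For `v` smooth and divergence free on `T³`, `q₀ > 1`, and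
`heatDissipation Φ_{q₀} v = 0` (an exact witness at the interior exponent `q₀`):
`∫ λ₁^{q₀−1} log λ₁ · μ(S; ΔS) = 0`. The violation function `g(q) = ∫ q λ₁^{q−1} μ ≤ 0` on
`[1, ∞)` (heat sieve) has the local maximum `g(q₀) = 0`, so
`g'(q₀) = ∫ λ₁^{q₀−1} μ + q₀ ∫ λ₁^{q₀−1} log λ₁ μ = 0`, and `∫ λ₁^{q₀−1} μ = 0`. [ours] -/
theorem integral_logTilt_eq_zero_of_exact {q₀ : ℝ} (hq₀ : 1 < q₀)
    {v : UnitAddTorus (Fin 3) → EuclideanSpace ℝ (Fin 3)} (hv : Torus.IsSmooth v)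
    (hdiv : Torus.IsDivFree v) (hD : heatDissipation (torusTopEigMoment q₀) v = 0) :
    ∫ x, torusStrainTopEig v x ^ (q₀ - 1) * Real.log (torusStrainTopEig v x) *
      dirTopEig (StrainL4.strainFlat v x) (StrainL4.strainFlat (Torus.laplacian v) x) = 0 := by
  obtain ⟨hint, hderiv⟩ := hasDerivAt_danskinIntegral_exponent hq₀ hv hv.laplacian hdiv
  have hq0 : q₀ ≠ 0 := by positivity
  have hfirst := integral_weight_danskin_eq_zero_of_exact hq₀.le hv hdiv hD
  have hg0 : ∫ x, q₀ * torusStrainTopEig v x ^ (q₀ - 1) *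
      dirTopEig (StrainL4.strainFlat v x) (StrainL4.strainFlat (Torus.laplacian v) x) = 0 := by
    have h := heatDissipation_topEigMoment_eq_integral hq₀.le hv hdiv
    rw [hD] at h
    linarith
  have hmax : IsLocalMax (fun q : ℝ => ∫ x, q * torusStrainTopEig v x ^ (q - 1) *
      dirTopEig (StrainL4.strainFlat v x) (StrainL4.strainFlat (Torus.laplacian v) x)) q₀ := by
    filter_upwards [Ioi_mem_nhds hq₀] with q hq
    rw [hg0]
    exact integral_danskinDensity_laplacian_nonpos (le_of_lt hq) hv hdiv
  have hzero := hmax.hasDerivAt_eq_zero hderiv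
  have hI1 : Integrable (fun x => torusStrainTopEig v x ^ (q₀ - 1) *
      dirTopEig (StrainL4.strainFlat v x) (StrainL4.strainFlat (Torus.laplacian v) x)) volume := by
    refine ((integrable_danskinDensity hq₀.le hv hv.laplacian hdiv).const_mul q₀⁻¹).congr
      (ae_of_all _ fun x => ?_)
    simp only
    field_simp
  have hI2 : Integrable (fun x => q₀ * (torusStrainTopEig v x ^ (q₀ - 1) *
      Real.log (torusStrainTopEig v x) *
        dirTopEig (StrainL4.strainFlat v x) (StrainL4.strainFlat (Torus.laplacian v) x)))
      volume := by
    refine (hint.sub hI1).congr (ae_of_all _ fun x => ?_)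
    simp only [Pi.sub_apply]
    ring
  have hsplit : ∫ x, (torusStrainTopEig v x ^ (q₀ - 1) +
      q₀ * (torusStrainTopEig v x ^ (q₀ - 1) * Real.log (torusStrainTopEig v x))) *
          dirTopEig (StrainL4.strainFlat v x) (StrainL4.strainFlat (Torus.laplacian v) x) =
      (∫ x, torusStrainTopEig v x ^ (q₀ - 1) *
        dirTopEig (StrainL4.strainFlat v x) (StrainL4.strainFlat (Torus.laplacian v) x)) +
      ∫ x, q₀ * (torusStrainTopEig v x ^ (q₀ - 1) * Real.log (torusStrainTopEig v x) *
        dirTopEig (StrainL4.strainFlat v x) (StrainL4.strainFlat (Torus.laplacian v) x)) := by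
    rw [← integral_add hI1 hI2]
    exact integral_congr_ae (ae_of_all _ fun x => by ring)
  rw [hsplit, hfirst, zero_add, integral_const_mul] at hzero
  exact (mul_eq_zero.mp hzero).resolve_left hq0

/-- **Exponent portrait of an exact witness (`T³`).** At an interior exponent `q₀ > 1` an exact
witness balances the Danskin mass AND its log-tilt: `∫ λ₁^{q₀−1} μ = 0` and
`∫ λ₁^{q₀−1} log λ₁ μ = 0` (`μ = μ(S; ΔS)`). [ours] -/
theorem exact_witness_exponent_portrait {q₀ : ℝ} (hq₀ : 1 < q₀)
    {v : UnitAddTorus (Fin 3) → EuclideanSpace ℝ (Fin 3)} (hv : Torus.IsSmooth v)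
    (hdiv : Torus.IsDivFree v) (hD : heatDissipation (torusTopEigMoment q₀) v = 0) :
    (∫ x, torusStrainTopEig v x ^ (q₀ - 1) *
      dirTopEig (StrainL4.strainFlat v x) (StrainL4.strainFlat (Torus.laplacian v) x) = 0) ∧
    ∫ x, torusStrainTopEig v x ^ (q₀ - 1) * Real.log (torusStrainTopEig v x) *
      dirTopEig (StrainL4.strainFlat v x) (StrainL4.strainFlat (Torus.laplacian v) x) = 0 :=
  ⟨integral_weight_danskin_eq_zero_of_exact hq₀.le hv hdiv hD,
    integral_logTilt_eq_zero_of_exact hq₀ hv hdiv hD⟩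

/-- **The exponent derivative of the heat dissipation VANISHES at an interior exact exponent**
(`T³`): exactness at `q₀ > 1` is a tangency in `q` (`heatDissipation Φ_q v ≥ 0` for every
`q ≥ 1` by the heat sieve, `= 0` at `q₀`: a local minimum of a differentiable function). [ours] -/
theorem hasDerivAt_heatDissipation_exponent_zero_of_exact {q₀ : ℝ} (hq₀ : 1 < q₀)
    {v : UnitAddTorus (Fin 3) → EuclideanSpace ℝ (Fin 3)} (hv : Torus.IsSmooth v)
    (hdiv : Torus.IsDivFree v) (hD : heatDissipation (torusTopEigMoment q₀) v = 0) :
    HasDerivAt (fun q : ℝ => heatDissipation (torusTopEigMoment q) v) 0 q₀ := by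
  have h := hasDerivAt_heatDissipation_exponent hq₀ hv hdiv
  have hmin : IsLocalMin (fun q : ℝ => heatDissipation (torusTopEigMoment q) v) q₀ := by
    filter_upwards [Ioi_mem_nhds hq₀] with q hq
    rw [hD, heatDissipation_topEigMoment_eq_integral (le_of_lt hq) hv hdiv]
    linarith [integral_danskinDensity_laplacian_nonpos (le_of_lt hq) hv hdiv]
  rwa [hmin.hasDerivAt_eq_zero h] at h

/-! ## 5. `ε`-violation is an open condition in the exponent -/

/-- **Strict `ε`-violation is open in `q`.** If `heatDissipation Φ_{q₀} v < ε · Φ_{q₀}(v)` at some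
`q₀ > 1` (`v` smooth and divergence free on `T^d`), then `heatDissipation Φ_q v < ε · Φ_q(v)` for
all `q` in a neighbourhood of `q₀`. [ours] -/
theorem eventually_lt_nhds_exponent_of_lt {q₀ ε : ℝ} (hq₀ : 1 < q₀)
    {v : UnitAddTorus d → EuclideanSpace ℝ d} (hv : Torus.IsSmooth v) (hdiv : Torus.IsDivFree v)
    (h : heatDissipation (torusTopEigMoment q₀) v < ε * torusTopEigMoment q₀ v) :
    ∀ᶠ q in 𝓝 q₀, heatDissipation (torusTopEigMoment q) v < ε * torusTopEigMoment q v :=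
  (continuousAt_heatDissipation_exponent hq₀ hv hdiv).eventually_lt
    (continuousAt_const.mul (continuousAt_topEigMoment_exponent (by linarith) hv)) h

end TopEig

end Summit.NavierStokesRegularity.FunctionalMining

end

-- search for candidate a priori estimates; no regularity claim
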